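import Literature.AnabelianGeometry.EtaleTheta.DivisorMonoidsOfGaloisCoveringConnected

/-!
# [EtTh] §3 p.72 / Prop. 3.4 (ii): the constant-field functor `D₀ → D^cnst = B(Spec K)⁰` for the coverings
# dominated by one universal combinatorial covering

S. Mochizuki, *The étale theta function …*, Publ. RIMS **45** (2009) [MochizukiEtTh2009], §3, p.72: "`D^cnst :=
B(Spec(K))⁰` … the natural surjection `Π^tp_X ↠ G_K` determines a natural functor `D₀ → D^cnst`"; Prop. 3.4 (ii)
p.74 ("natural isomorphisms … `L^× ⥲ F₀(Y^log)`", `Spec L = ` the image of `Y^log` in `D^cnst`)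
[cite: MochizukiEtTh2009, Def 3.3 p.73].

CLASS (b) CONSTRUCTION + one CLASS (c) predicate bundle (abc-iut cell; frozen/landed files consumed BY NAME).  At the
data of one universal combinatorial covering `Z^log_∞` (`Z : LogDivisorModel`, `G = Gal(Z^log_∞/X^log)` acting by
`A : Z.GaloisAction G`) the constant field of a covering `Y ↔ S = G/H` is `L'^{π(H)}`, `π : G ↠ Gal(L'/K)` the
action on the constants `L'^× = Z.const` of `Z^log_∞`.  On the interface this reads:

* `GaloisAction.constInertia A` — `N := Ker(G → Aut(L'^×))`, the elements acting trivially on the constants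
  (a normal subgroup, `constInertia_normal`);
* `GaloisAction.constQuot A : Action (Type u) G ⥤ Action (Type u) G` — `S ↦ N∖S` with the induced `G`-action
  (`G` acts through `G/N = Gal(L'/K)`): the covering `Y` goes to (the `G_K`-set of) its constant field;
  `GaloisAction.cnstFunctor A` — its restriction to the connected coverings `isConnectedGSet` (Def. 3.3's `D₀`),
  i.e. the functor `D₀ → D^cnst` at this term of the limit; `constQuot_map_eq_iff` — two covering maps have the
  same image in `D^cnst` iff they differ pointwise by elements of `N`;
* `GaloisAction.ConstGaloisLaw A` (predicate bundle, class (c); BINDER, GAP row G-w6d058-2) — the one property of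
  the constant-field extension `L'/K` that the interface cannot see: "an element of `G` fixing every
  `H`-invariant UNIT integral constant lies in `N·H`" (the Galois correspondence for the finite Galois extension
  `L'/K` together with "`O_L^×` generates `L`"; print: Thm. 3.7 (iii) p.80 "`Aut(L/K)` acts faithfully on
  `O_L^×`").  Inhabited at the trivial action (`constGaloisLaw_trivial`).
The Prop. 3.4 (ii) naturality clauses `DivisorMonoids.Prop34Cnst₀` relative to `cnstFunctor` are PROVED (clauses
1–2 outright, clause 3 from the binder) in `Discharge/Sec3Prop34CnstOfGaloisCovering.lean`.  No named Prop fact, no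
instance, no sorry.  HONEST FRAMING: a construction over typed interfaces; nothing here bears on [IUTchIII]
Cor. 3.12; typed ≠ proved.
-/

namespace Literature.AnabelianGeometry.EtaleTheta

open CategoryTheory Opposite

universe u

namespace LogDivisorModel.GaloisAction

variable {Z : LogDivisorModel.{u}} {G : Type u} [Group G] (A : Z.GaloisAction G)

/-! ## `N = Ker(G → Aut(L'^×))`: the elements acting trivially on the constants -/

/-- **`N := constInertia`**: the subgroup of `G = Gal(Z^log_∞/X^log)` acting trivially on the constants
`L'^× = const` of `Z^log_∞` (the kernel of `G → Gal(L'/K)`). [cite: MochizukiEtTh2009, Def 3.3 p.73] -/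
def constInertia : Subgroup G where
  carrier := {g | ∀ f ∈ Z.const, A.actFn g f = f}
  mul_mem' {a b} ha hb f hf := by
    show A.actFn (a * b) f = f
    rw [map_mul, MulAut.mul_apply, hb f hf, ha f hf]
  one_mem' f _ := by
    show A.actFn 1 f = f
    rw [map_one, MulAut.one_apply]
  inv_mem' {a} ha f hf := by
    show A.actFn a⁻¹ f = f
    conv_lhs => rw [← ha f hf]
    rw [← MulAut.mul_apply, ← map_mul, inv_mul_cancel, map_one, MulAut.one_apply]

/-- Membership in `N`. [cite: MochizukiEtTh2009, Def 3.3 p.73] -/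
theorem mem_constInertia_iff (g : G) : g ∈ A.constInertia ↔ ∀ f ∈ Z.const, A.actFn g f = f := Iff.rfl

/-- `N` is normal (the constants are `G`-stable). [cite: MochizukiEtTh2009, Def 3.3 p.73] -/
theorem constInertia_normal : (A.constInertia).Normal := by
  refine ⟨fun n hn g f hf => ?_⟩
  show A.actFn (g * n * g⁻¹) f = f
  rw [map_mul, map_mul, MulAut.mul_apply, MulAut.mul_apply, hn _ (A.act_mem_const g⁻¹ hf),
    ← MulAut.mul_apply, ← map_mul, mul_inv_cancel, map_one, MulAut.one_apply]

/-! ## The quotient `S ↦ N∖S` of a `G`-set and the constant-field functor -/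

section Quot

variable (S : Action (Type u) G)

/-- `(g h) · s = g · (h · s)` (structure action of a `G`-set). [folklore] -/
private theorem ρ_mul_apply (g h : G) (s : S.V) : S.ρ (g * h) s = S.ρ g (S.ρ h s) := by
  rw [map_mul]; rfl

/-- `1 · s = s`. [folklore] -/
private theorem ρ_one_apply (s : S.V) : S.ρ (1 : G) s = s := by
  rw [map_one]; rfl

/-- Morphisms of `G`-sets are equivariant, pointwise. [folklore] -/
private theorem hom_ρ_apply' {S S' : Action (Type u) G} (f : S ⟶ S') (g : G) (s : S.V) :
    f.hom (S.ρ g s) = S'.ρ g (f.hom s) := by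
  have h := f.comm g
  exact congrFun (congrArg (fun φ : S.V ⟶ S'.V => (φ : S.V → S'.V)) h) s

/-- The `N`-orbit relation on a `G`-set: `s ∼ t` iff `t = n · s` for some `n ∈ N`.
[cite: MochizukiEtTh2009, Def 3.3 p.73] -/
def constOrbitSetoid : Setoid S.V where
  r s t := ∃ n ∈ A.constInertia, S.ρ n s = t
  iseqv :=
    { refl := fun s => ⟨1, A.constInertia.one_mem, ρ_one_apply S s⟩
      symm := by
        rintro s t ⟨n, hn, rfl⟩
        exact ⟨n⁻¹, A.constInertia.inv_mem hn, by rw [← ρ_mul_apply, inv_mul_cancel, ρ_one_apply]⟩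
      trans := by
        rintro s t v ⟨n, hn, rfl⟩ ⟨m, hm, rfl⟩
        exact ⟨m * n, A.constInertia.mul_mem hm hn, ρ_mul_apply S m n s⟩ }

/-- The relation of `constOrbitSetoid`. [cite: MochizukiEtTh2009, Def 3.3 p.73] -/
theorem constOrbitSetoid_r (s t : S.V) : (A.constOrbitSetoid S).r s t ↔ ∃ n ∈ A.constInertia, S.ρ n s = t :=
  Iff.rfl

/-- The `G`-action on `N∖S` (well defined because `N` is normal). [cite: MochizukiEtTh2009, Def 3.3 p.73] -/
def constQuotMap (g : G) : Quotient (A.constOrbitSetoid S) → Quotient (A.constOrbitSetoid S) :=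
  Quotient.map' (S.ρ g) fun s t h => by
    obtain ⟨n, hn, rfl⟩ := h
    refine ⟨g * n * g⁻¹, (A.constInertia_normal).conj_mem n hn g, ?_⟩
    rw [ρ_mul_apply, ρ_mul_apply, ← ρ_mul_apply S g⁻¹ g, inv_mul_cancel, ρ_one_apply]

/-- `constQuotMap g ⟦s⟧ = ⟦g · s⟧`. [cite: MochizukiEtTh2009, Def 3.3 p.73] -/
@[simp] theorem constQuotMap_mk (g : G) (s : S.V) :
    A.constQuotMap S g (Quotient.mk _ s) = Quotient.mk _ (S.ρ g s) := rfl

/-- The `G`-action on `N∖S` as a monoid homomorphism into `End`. [cite: MochizukiEtTh2009, Def 3.3 p.73] -/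
def constQuotρ : G →* End (Quotient (A.constOrbitSetoid S)) where
  toFun g := TypeCat.ofHom (A.constQuotMap S g)
  map_one' := by
    refine ConcreteCategory.hom_ext _ _ fun q => ?_
    induction q using Quotient.ind with
    | _ s =>
      change A.constQuotMap S 1 (Quotient.mk _ s) = Quotient.mk _ s
      rw [constQuotMap_mk, ρ_one_apply]
  map_mul' g h := by
    refine ConcreteCategory.hom_ext _ _ fun q => ?_
    induction q using Quotient.ind with
    | _ s =>
      change A.constQuotMap S (g * h) (Quotient.mk _ s) = A.constQuotMap S g (A.constQuotMap S h (Quotient.mk _ s))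
      rw [constQuotMap_mk, constQuotMap_mk, constQuotMap_mk, ρ_mul_apply]

/-- **`N∖S` as a `G`-set** (the constant field of the covering `S`, with its `G_K = G/N`-action seen through `G`).
[cite: MochizukiEtTh2009, Def 3.3 p.73] -/
def constQuotObj : Action (Type u) G where
  V := Quotient (A.constOrbitSetoid S)
  ρ := A.constQuotρ S

/-- The structure action of `N∖S` on classes. [cite: MochizukiEtTh2009, Def 3.3 p.73] -/
@[simp] theorem constQuotObj_ρ_mk (g : G) (s : S.V) :
    (A.constQuotObj S).ρ g (Quotient.mk (A.constOrbitSetoid S) s) = Quotient.mk _ (S.ρ g s) := rfl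

/-- Two points of `S` have the same image in `N∖S` iff they differ by an element of `N`.
[cite: MochizukiEtTh2009, Def 3.3 p.73] -/
theorem constQuot_mk_eq_mk_iff (s t : S.V) :
    (Quotient.mk (A.constOrbitSetoid S) s : (A.constQuotObj S).V) = Quotient.mk _ t ↔
      ∃ n ∈ A.constInertia, S.ρ n s = t :=
  Quotient.eq

variable {S} {S' S'' : Action (Type u) G}

/-- The map `N∖S → N∖S'` induced by a covering map, on the quotient types. [cite: MochizukiEtTh2009, Def 3.3 p.73] -/
def constQuotFun (f : S ⟶ S') : Quotient (A.constOrbitSetoid S) → Quotient (A.constOrbitSetoid S') :=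
  Quotient.map' f.hom fun s t h => by
    obtain ⟨n, hn, rfl⟩ := h
    exact ⟨n, hn, (hom_ρ_apply' f n s).symm⟩

/-- `constQuotFun f ⟦s⟧ = ⟦f s⟧`. [cite: MochizukiEtTh2009, Def 3.3 p.73] -/
@[simp] theorem constQuotFun_mk (f : S ⟶ S') (s : S.V) :
    A.constQuotFun f (Quotient.mk (A.constOrbitSetoid S) s) = Quotient.mk _ (f.hom s) := rfl

/-- The map `N∖S → N∖S'` induced by a covering map, as a morphism of `G`-sets.
[cite: MochizukiEtTh2009, Def 3.3 p.73] -/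
def constQuotHom (f : S ⟶ S') : A.constQuotObj S ⟶ A.constQuotObj S' where
  hom := TypeCat.ofHom (A.constQuotFun f)
  comm g := by
    refine ConcreteCategory.hom_ext _ _ fun q => ?_
    induction q using Quotient.ind with
    | _ s =>
      change A.constQuotFun f (A.constQuotMap S g (Quotient.mk _ s)) =
        A.constQuotMap S' g (A.constQuotFun f (Quotient.mk _ s))
      rw [constQuotMap_mk, constQuotFun_mk, constQuotFun_mk, constQuotMap_mk, hom_ρ_apply']

/-- `constQuotHom f ⟦s⟧ = ⟦f s⟧`. [cite: MochizukiEtTh2009, Def 3.3 p.73] -/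
@[simp] theorem constQuotHom_mk (f : S ⟶ S') (s : S.V) :
    (A.constQuotHom f).hom (Quotient.mk (A.constOrbitSetoid S) s) = Quotient.mk _ (f.hom s) := rfl

end Quot

/-- **The constant-field functor on all coverings dominated by `Z^log_∞`**: `S ↦ N∖S`.
[cite: MochizukiEtTh2009, Def 3.3 p.73] -/
def constQuot : Action (Type u) G ⥤ Action (Type u) G where
  obj S := A.constQuotObj S
  map f := A.constQuotHom f
  map_id S := by
    refine Action.hom_ext _ _ (ConcreteCategory.hom_ext _ _ fun q => ?_)
    induction q using Quotient.ind with
    | _ s => rfl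
  map_comp f g := by
    refine Action.hom_ext _ _ (ConcreteCategory.hom_ext _ _ fun q => ?_)
    induction q using Quotient.ind with
    | _ s => rfl

/-- `constQuot` on objects. [cite: MochizukiEtTh2009, Def 3.3 p.73] -/
theorem constQuot_obj (S : Action (Type u) G) : A.constQuot.obj S = A.constQuotObj S := rfl

/-- `constQuot` on morphisms, on classes. [cite: MochizukiEtTh2009, Def 3.3 p.73] -/
@[simp] theorem constQuot_map_mk {S S' : Action (Type u) G} (f : S ⟶ S') (s : S.V) :
    (A.constQuot.map f).hom (Quotient.mk (A.constOrbitSetoid S) s) = Quotient.mk _ (f.hom s) := rfl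

/-- **Two covering maps have the same image in `D^cnst` iff they differ pointwise by elements of `N`.**
[cite: MochizukiEtTh2009, Def 3.3 p.73] -/
theorem constQuot_map_eq_iff {S S' : Action (Type u) G} (f f' : S ⟶ S') :
    A.constQuot.map f = A.constQuot.map f' ↔ ∀ s, ∃ n ∈ A.constInertia, S'.ρ n (f.hom s) = f'.hom s := by
  constructor
  · intro h s
    have hs := congrArg (fun φ : A.constQuot.obj S ⟶ A.constQuot.obj S' =>
      (φ.hom : (A.constQuotObj S).V → (A.constQuotObj S').V) (Quotient.mk (A.constOrbitSetoid S) s)) h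
    simp only [constQuot_map_mk] at hs
    exact (A.constQuot_mk_eq_mk_iff S' _ _).1 hs
  · intro h
    refine Action.hom_ext _ _ (ConcreteCategory.hom_ext _ _ fun q => ?_)
    induction q using Quotient.ind with
    | _ s =>
      change (A.constQuot.map f).hom (Quotient.mk _ s) = (A.constQuot.map f').hom (Quotient.mk _ s)
      rw [constQuot_map_mk, constQuot_map_mk]
      exact (A.constQuot_mk_eq_mk_iff S' _ _).2 (h s)

/-- **The functor `D₀ → D^cnst`** at this term of the limit: the constant-field functor restricted to the
connected coverings. [cite: MochizukiEtTh2009, Def 3.3 p.73] -/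
def cnstFunctor : (isConnectedGSet (G := G)).FullSubcategory ⥤ Action (Type u) G :=
  (isConnectedGSet (G := G)).ι ⋙ A.constQuot

/-- `cnstFunctor` on morphisms is `constQuot` on the underlying covering map. [cite: MochizukiEtTh2009, Def 3.3 p.73] -/
theorem cnstFunctor_map {Y Y' : (isConnectedGSet (G := G)).FullSubcategory} (g : Y ⟶ Y') :
    A.cnstFunctor.map g = A.constQuot.map g.hom := rfl

/-- Two covering maps of connected coverings have the same image under `D₀ → D^cnst` iff they differ pointwise by
elements of `N`. [cite: MochizukiEtTh2009, Def 3.3 p.73] -/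
theorem cnstFunctor_map_eq_iff {Y Y' : (isConnectedGSet (G := G)).FullSubcategory} (g g' : Y ⟶ Y') :
    A.cnstFunctor.map g = A.cnstFunctor.map g' ↔
      ∀ s, ∃ n ∈ A.constInertia, Y'.obj.ρ n (g.hom.hom s) = g'.hom.hom s :=
  A.constQuot_map_eq_iff g.hom g'.hom

/-! ## The Galois-correspondence law for the constants (binder) -/

/-- **Galois correspondence for the constant field, unit form** (predicate bundle, class (c); BINDER — a property
of the constant-field extension `L'/K` the interface does not record): an element of `G` fixing every
`H`-invariant unit integral constant lies in `N·H` (`N = constInertia`).  In print: `Gal(L'/K)` finite Galois,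
`L'^{π(H)} = L` the constant field of `Y`, and "`Aut(L/K)` acts faithfully on `O_L^×`" (Thm. 3.7 (iii), p.80).
[cite: MochizukiEtTh2009, Thm 3.7 (iii) p.79] -/
structure ConstGaloisLaw : Prop where
  /-- an element fixing all `H`-invariant unit integral constants lies in `N·H` -/
  exists_mem_constInertia : ∀ (H : Subgroup G) (a : G),
    (∀ u : Z.Fn, u ∈ Z.intConst → u⁻¹ ∈ Z.intConst → (∀ h ∈ H, A.actFn h u = u) → A.actFn a u = u) →
      ∃ n ∈ A.constInertia, n⁻¹ * a ∈ H

/-- The trivial action satisfies the law (`N = G`): the binder is inhabited. [cite: MochizukiEtTh2009, Thm 3.7 (iii) p.79] -/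
theorem constGaloisLaw_trivial (Z : LogDivisorModel.{u}) (G : Type u) [Group G] :
    (GaloisAction.trivial Z G).ConstGaloisLaw :=
  ⟨fun H a _ => ⟨a, fun _ _ => rfl, by rw [inv_mul_cancel]; exact H.one_mem⟩⟩

end LogDivisorModel.GaloisAction

end Literature.AnabelianGeometry.EtaleTheta
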